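import Summits.HodgeConjecture.HodgeConjecture.Theorems.UeP4UnivFamilyLDeltaClass
import Summits.HodgeConjecture.HodgeConjecture.Theorems.SiegelUniversalFamilyHodgeFrames
import Literature.AlgebraicGeometry.HodgeTheory.AbelianVarietyHyperplaneEulerClassCupFrame
import Literature.AlgebraicGeometry.HodgeTheory.AbelianVarietyTorusModelRigidityScalar
import Literature.AlgebraicGeometry.HodgeTheory.LDeltaFibreClassTranslate
import Literature.AlgebraicGeometry.AbelianSchemes.AbelianSchemeLDeltaBaseChange
import Literature.AlgebraicGeometry.Motives.ProjectiveEmbeddingPadding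
import Literature.AlgebraicGeometry.HodgeTheory.AbelianVarietyLDeltaHyperplaneGram
import Summits.HodgeConjecture.HodgeConjecture.Theorems.SiegelUniversalFamilyCupFrameIndependent
import Literature.AlgebraicGeometry.HodgeTheory.RationalExteriorSpan
import Literature.AlgebraicGeometry.Motives.ComplexPointsManifold
import Literature.AlgebraicGeometry.Motives.ComplexPointsParacompact
import HarnessLib

/-!
# U-e (N3-core) assembler: one global class reads the polarisation Gram at both points of a pair

Sub-problem `HodgeConjecture` (cell HC_CM, (U)-lane node U-e P4, (N3-core) «the polarisation Gram is flat in a flat integral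
frame»; P4 lead / assembler B-p03 (g14)).  Discharges the ASSEMBLER SOCKET (R) `UHead.Ue_N3asm_pairReading` of the lead's HOME
sockets file v0.10: for the complexified universal family `X ⊗ ℂ → M ⊗ ℂ` of the Siegel fine moduli scheme, fibre triples `P′ y`
with base-change witnesses, a flat rational frame `γ`, framed uniformisations `(Φ y, φ y)` and ample `IsLambdaOfAt` witnesses
`Θ y`, and for a PAIR of points `x₀, x ∈ W` with Appell–Humbert data `p₀, p` of `𝒪(Θ x₀)^an`, `𝒪(Θ x)^an`, there is ONE class
`C ∈ H²((X ⊗ ℂ)(ℂ); ℂ)` and ONE scalar `c ≠ 0` with `C|_{X_y} = c • Σ_a Σ_b E_y(λ_a, λ_b) (γ_y a ⊗ 1) ⌣ (γ_y b ⊗ 1)` at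
`y = x₀` and at `y = x`.  ROAD ([MumfordFogartyKirwan1994] Ch. 6 §2 Prop. 6.10; [VoisinHodgeII2003] §3.1.2; [LangeBirkenhake1992]
Ch. 2 Thm. 2.1.2, Ch. 4 Thm. 4.5.1): `C` is the topological ℂ-Euler class of (a cocycle of) `(L^Δ(λ^univ))^{-q}` on `(X ⊗ ℂ)(ℂ)`;
on the fibre at `y` (★ `UnivFamilyLDeltaClass.coreEulerClass_fibre_reading`) its class is `[L^Δ(λ_y)]^{-q}` (★
`AbelianSchemeLDeltaBaseChange`), `[L^Δ(λ_y)]` is the class of an ample translate `D_y` of `2 Θ_y` (★ `LDeltaFibreClassTranslate`),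
`q • D_y` is a hyperplane section of a closed immersion `ψ_y : A_y ⟶ ℙᴷ` with ONE `(q, K)` for the pair (★
`ProjectiveEmbeddingPadding`), so that the per-fibre composite (★ `AbelianVarietyHyperplaneEulerClassCupFrame`) computes it as
`(μ_K r⁻¹) • (½ Σ Σ (2q E_y) γ⌣γ) ⊗ 1` with the ℙᴷ-line constant `μ_K` and ONE rigidity scalar `r` for all torus models of
record (★ `AbelianVarietyTorusModelRigidityScalar`); `c := μ_K r⁻¹ q`.  Main result: `ue_N3asm_pairReading_holds` (socket text,
`IsFlatIntegralFrame` spelled out).  HC_CM is proved only modulo the 7 printed citations until rung 0 closes; this helper changes no count.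

## References
* [MumfordFogartyKirwan1994] D. Mumford, J. Fogarty, F. Kirwan, *Geometric Invariant Theory*, 3rd ed., Ch. 6 §2 Prop. 6.10 (p. 121),
  Ch. 7 §2 Def. 7.2 (p. 129), §3 Thm. 7.9 (p. 139).
* [VoisinHodgeII2003] C. Voisin, *Hodge Theory and Complex Algebraic Geometry II*, CUP 2003, §3.1.2.
* [LangeBirkenhake1992] H. Lange, Ch. Birkenhake, *Complex Abelian Varieties*, Springer 1992, Ch. 2 §2.1 Thm. 2.1.2, Ch. 4 Thm. 4.5.1,
  Ch. 8 §8.1.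
* [Hartshorne1977] R. Hartshorne, *Algebraic Geometry*, Springer 1977, II Thm. 7.6, III Ex. 4.5.
* [MilnorStasheff1974] J. Milnor, J. Stasheff, *Characteristic Classes*, Princeton 1974, §14 Thm. 14.4.
-/

set_option autoImplicit false
set_option linter.dupNamespace false

noncomputable section

open CategoryTheory CategoryTheory.Limits AlgebraicGeometry Matrix Topology
open Literature.AlgebraicGeometry
open Literature.AlgebraicGeometry.Motives (SchemeOver ComplexPoints AlgPoints specOver AbelianVariety CartierDivisor fiberOver)
open Literature.AlgebraicGeometry.Motives
open Literature.AlgebraicGeometry.Modules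
open Literature.AlgebraicGeometry.HodgeTheory
open Literature.AlgebraicGeometry.AbelianSchemes (PolarizedAbelianSchemeWithLevel AbelianSchemeOver)
open Literature.AlgebraicGeometry.ModuliOfAbelianVarieties
open Literature.AlgebraicGeometry.ModuliOfAbelianVarieties.SiegelModuli
open Literature.AlgebraicGeometry.ModuliOfAbelianVarieties.W1
open Literature.Geometry.Kaehler (ComplexTorus)
open Literature.NumberTheory.Transcendental (IsAnalytification)
open Literature.NumberTheory.Automorphic (siegelUpperHalfSpace)
open Literature.NumberTheory.Adeles
open Literature.AlgebraicTopology.SingularHomology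
open Literature.AlgebraicTopology.CharacteristicClasses

namespace Summit.HodgeConjecture.HodgeConjecture.Theorems

namespace UnivFamilyPairReading

/-! ### §0 The reading algebra: `(μ r⁻¹) • (½ Σ Σ (2q M) γᴬ⌣γᴬ) ⊗ 1 = e^*((μ r⁻¹ q) • Σ Σ M γ̂⌣γ̂)` -/

/-- Bookkeeping: complexification, the `2 × ½` cancellation, and naturality of `⊗ 1` and `⌣` along the pinned homeomorphism.
[cite: HatcherAT2002, §3.2 Prop. 3.10] -/
theorem reading_algebra {ι : Type} [Fintype ι] {X X' : Type} [TopologicalSpace X] [TopologicalSpace X'] (e : C(X', X))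
    (γ : ι → singularCohomology ℚ ℚ X 1) (M M' : Matrix ι ι ℤ) (q : ℕ) (hM : M' = (2 * q) • M) (μ r : ℂ) :
    (μ * r⁻¹) • ofRatClass X' 2 ((1 / 2 : ℚ) • ∑ a, ∑ b, ((M' a b : ℤ) : ℚ) •
        cupPowOne ℚ X' 2 ![singularCohomology.map ℚ ℚ e 1 (γ a), singularCohomology.map ℚ ℚ e 1 (γ b)]) =
      singularCohomology.map ℂ ℂ e 2 ((μ * r⁻¹ * q) • ∑ a, ∑ b, ((M a b : ℤ) : ℂ) •
        cupProduct (show 1 + 1 = 2 from rfl) (ofRatClass X 1 (γ a)) (ofRatClass X 1 (γ b))) := by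
  subst hM
  simp only [map_smul, map_sum, Motives.ofRatClass_smul, UnivFamilyCupFrame.cupPowOne_two_eq_cupProduct, cupProduct_map,
    Finset.smul_sum, smul_smul, Matrix.smul_apply, Int.cast_mul, Int.cast_ofNat, Int.cast_natCast, Rat.cast_mul,
    Rat.cast_intCast, Rat.cast_natCast, Rat.cast_ofNat, Rat.cast_div, Rat.cast_one, nsmul_eq_mul, Nat.cast_mul,
    Nat.cast_ofNat, Matrix.cons_val_zero, Matrix.cons_val_one]
  refine Finset.sum_congr rfl fun a _ ↦ Finset.sum_congr rfl fun b _ ↦ ?_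
  rw [RationalExteriorSpan.ofRatClass_cupProduct, Motives.ofRatClass_map, Motives.ofRatClass_map]
  congr 1
  field_simp

/-! ### §1 The socket (R), proved -/

/-- **ASSEMBLER SOCKET (R) DISCHARGED — `ue_N3asm_pairReading_holds`** (the lead's `UHead.Ue_N3asm_pairReading` v0.10 :1307 with
`IsFlatIntegralFrame` spelled out). [cite: MumfordFogartyKirwan1994, Ch. 6 §2 Prop. 6.10 (p. 121)] [cite: VoisinHodgeII2003, §3.1.2]
[cite: LangeBirkenhake1992, Ch. 8 §8.1] -/
theorem ue_N3asm_pairReading_holds :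
    ∀ (g N : ℕ) (δ : Fin g → ℕ) (_hg : 0 < g) (_hδ : IsPolarizationType δ) (_hN : 3 ≤ N)
      (𝓜 : SiegelFineModuliScheme g N δ) (_hMq : HodgeTheory.IsQuasiProjectiveOver 𝓜.M)
      (_hXq : HodgeTheory.IsQuasiProjectiveOver (W1.univTotal 𝓜))
      (d : ℕ) [SmoothOfRelativeDimension d ((Motives.baseChange ℚ ℂ).obj 𝓜.M).hom],
      haveI : IsLocallyNoetherian (specOver ℚ ℂ).left :=
        inferInstanceAs (IsLocallyNoetherian (Spec (CommRingCat.of ℂ)))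
      ∀ (W : Set (ComplexPoints ((Motives.baseChange ℚ ℂ).obj 𝓜.M))) (_hW : IsPathConnected W)
        (hU : HodgeTheory.IsCohomologicallyLocallyTrivialOn (W1.univFamilyℂ 𝓜) W)
        (P' : W → PolarizedAbelianSchemeWithLevel g N δ (specOver ℚ ℂ).left)
        (G : ∀ x : W, (P' x).A.X.left ⟶ 𝓜.univ.A.X.left) (Ĝ : ∀ x : W, (P' x).D.hat.X.left ⟶ 𝓜.univ.D.hat.X.left)
        (hbc : ∀ x : W, (P' x).IsBaseChangeVia 𝓜.univ
          ((AlgPoints.baseChangeEquiv (algebraMap ℚ ℂ) 𝓜.M).symm x.1).left (G x) (Ĝ x))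
        (γ : ∀ x : W, Fin g ⊕ Fin g →
          singularCohomology ℚ ℚ (ComplexPoints (fiberOver (W1.univFamilyℂ 𝓜) x.1)) 1)
        (Φ : ∀ _x : W, (Fin g ⊕ Fin g → ℝ) ≃L[ℝ] (Fin g → ℂ))
        (φ : ∀ x : W, C(ComplexTorus (Φ x), ((P' x).A.fibre (𝟙 (Spec (CommRingCat.of ℂ)))).toAbelianVariety.Points ℂ))
        (hφ : ∀ x : W, IsAnalytification (Fin g → ℂ)
          ((P' x).A.fibre (𝟙 (Spec (CommRingCat.of ℂ)))).toAbelianVariety.X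
          ((P' x).A.fibre (𝟙 (Spec (CommRingCat.of ℂ)))).toAbelianVariety.dim (φ x))
        (Θ : ∀ x : W, CartierDivisor ((P' x).A.fibre (𝟙 (Spec (CommRingCat.of ℂ)))).toAbelianVariety.X.left),
        ((∀ x : W, LinearIndependent ℂ fun a => HodgeTheory.ofRatClass _ 1 (γ x a)) ∧
          (∀ (x : W) (c : HodgeTheory.complexBetti (fiberOver (W1.univFamilyℂ 𝓜) x.1) 1),
              HodgeTheory.IsIntegralClass c ↔
                c ∈ Submodule.span ℤ (Set.range fun a => HodgeTheory.ofRatClass _ 1 (γ x a))) ∧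
          ∀ (x x' : W) (p : Path.Homotopic.Quotient x x') (a : Fin g ⊕ Fin g),
            HodgeTheory.transportFun (W1.univFamilyℂ 𝓜) 1 hU p (HodgeTheory.ofRatClass _ 1 (γ x a)) =
              HodgeTheory.ofRatClass _ 1 (γ x' a)) →
        (∀ (x : W) (s t : ComplexTorus (Φ x)), φ x (s + t) = φ x s * φ x t) →
        (∀ (x : W) (a : Fin g ⊕ Fin g),
          singularCohomology.map ℚ ℚ
              (((Motives.AlgPoints.homeomorphOfIso (L := ℂ)
                  (W1.fibreAVIso (P' x) ≪≫
                    (W1.fiberUnivIsoOfIsBaseChangeVia 𝓜 x.1 (P' x) (G x) (Ĝ x) (hbc x)).symm) :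
                  ((P' x).A.fibre (𝟙 (Spec (CommRingCat.of ℂ)))).toAbelianVariety.Points ℂ ≃ₜ
                    ComplexPoints (fiberOver (W1.univFamilyℂ 𝓜) x.1)) :
                C(((P' x).A.fibre (𝟙 (Spec (CommRingCat.of ℂ)))).toAbelianVariety.Points ℂ,
                  ComplexPoints (fiberOver (W1.univFamilyℂ 𝓜) x.1))).comp (φ x)) 1 (γ x a) =
            HodgeTheory.latticeClass (Φ x) a) →
        (∀ x : W, (Θ x).IsAmple) →
        (∀ x : W, (P' x).A.IsLambdaOfAt (𝟙 (Spec (CommRingCat.of ℂ))) (P' x).D (P' x).pol.lam (Θ x)) →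
        ∀ (x₀ x : W) (p₀ : ComplexTorus.AHData (Φ x₀)) (p : ComplexTorus.AHData (Φ x)),
          ComplexTorus.AHData.toPic p₀ =
              ComplexTorus.picClass (HodgeTheory.cartierDivisorLineBundle (hφ x₀) (Θ x₀)) →
          ComplexTorus.AHData.toPic p =
              ComplexTorus.picClass (HodgeTheory.cartierDivisorLineBundle (hφ x) (Θ x)) →
          ∃ (C : HodgeTheory.complexBetti ((Motives.baseChange ℚ ℂ).obj (W1.univTotal 𝓜)) 2) (c : ℂ), c ≠ 0 ∧
            HodgeTheory.complexBetti.map (Motives.fiberι (W1.univFamilyℂ 𝓜) x₀.1) 2 C =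
              c • ∑ a, ∑ b, ((ComplexTorus.intGram (Φ x₀) p₀.form a b : ℤ) : ℂ) •
                cupProduct (show 1 + 1 = 2 from rfl) (HodgeTheory.ofRatClass _ 1 (γ x₀ a)) (HodgeTheory.ofRatClass _ 1 (γ x₀ b)) ∧
            HodgeTheory.complexBetti.map (Motives.fiberι (W1.univFamilyℂ 𝓜) x.1) 2 C =
              c • ∑ a, ∑ b, ((ComplexTorus.intGram (Φ x) p.form a b : ℤ) : ℂ) •
                cupProduct (show 1 + 1 = 2 from rfl) (HodgeTheory.ofRatClass _ 1 (γ x a)) (HodgeTheory.ofRatClass _ 1 (γ x b)) := by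
  intro g N δ hg hδ hN 𝓜 hMq hXq d _ W hW hU P' G Ĝ hbc γ Φ φ hφ Θ hflat hadd hframe hΘ hlam x₀ x p₀ p hp₀ hp
  classical
  have hN0 : N ≠ 0 := by omega
  /- ### instances: base, total space, fibres, `ℙᴷ` -/
  have hf := UnivFamilyHodgeFrames.isSmoothProjectiveFamily_univFamilyℂ_of_classify 𝓜
  have hMc : IsQuasiProjectiveOver ((Motives.baseChange ℚ ℂ).obj 𝓜.M) :=
    UnivFamilyHodgeFrames.isQuasiProjectiveOver_baseChange_M 𝓜 hMq
  haveI : SmoothOfRelativeDimension g (univFamilyℂ 𝓜).left := hf.smoothOfRelativeDimension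
  haveI : IsProper (univFamilyℂ 𝓜).left := hf.isProper
  haveI : LocallyOfFiniteType ((Motives.baseChange ℚ ℂ).obj 𝓜.M).hom := hMc.isVarietyPair_ofScheme.locallyOfFiniteType
  haveI : IsSeparated ((Motives.baseChange ℚ ℂ).obj 𝓜.M).hom := hMc.isVarietyPair_ofScheme.isSeparated
  haveI : QuasiCompact ((Motives.baseChange ℚ ℂ).obj 𝓜.M).hom := hMc.isVarietyPair_ofScheme.quasiCompact
  have hXhom : ((Motives.baseChange ℚ ℂ).obj (univTotal 𝓜)).hom =
      (univFamilyℂ 𝓜).left ≫ ((Motives.baseChange ℚ ℂ).obj 𝓜.M).hom := (Over.w (univFamilyℂ 𝓜)).symm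
  haveI : LocallyOfFiniteType ((Motives.baseChange ℚ ℂ).obj (univTotal 𝓜)).hom := by rw [hXhom]; infer_instance
  haveI : IsSeparated ((Motives.baseChange ℚ ℂ).obj (univTotal 𝓜)).hom := by rw [hXhom]; infer_instance
  haveI : QuasiCompact ((Motives.baseChange ℚ ℂ).obj (univTotal 𝓜)).hom := by rw [hXhom]; infer_instance
  haveI : SmoothOfRelativeDimension (g + d) ((Motives.baseChange ℚ ℂ).obj (univTotal 𝓜)).hom := by
    rw [hXhom]; infer_instance
  haveI : CompactSpace ((Motives.baseChange ℚ ℂ).obj (univTotal 𝓜)).left :=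
    QuasiCompact.compactSpace_of_compactSpace ((Motives.baseChange ℚ ℂ).obj (univTotal 𝓜)).hom
  haveI : SecondCountableTopology (ComplexPoints ((Motives.baseChange ℚ ℂ).obj (univTotal 𝓜))) :=
    ComplexPoints.secondCountableTopology_of_compactSpace_holds _
  haveI : T2Space (ComplexPoints ((Motives.baseChange ℚ ℂ).obj (univTotal 𝓜))) :=
    ComplexPoints.t2Space_of_isSeparated _
  haveI : ParacompactSpace (ComplexPoints ((Motives.baseChange ℚ ℂ).obj (univTotal 𝓜))) :=
    ComplexPoints.paracompactSpace_of_smooth _ (g + d)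
  haveI hP2 : T2Space (ComplexPoints (projectiveSpace 0 ℂ)) :=
    ComplexPoints.t2Space_of_isSmoothProjective (isSmoothProjective_projectiveSpace' 0)
  /- ### the universal `L^Δ(λ)` and its (inverse) class -/
  set Gr : 𝓜.univ.A.X.left ⟶ 𝓜.univ.A.prodLeft 𝓜.univ.D.hat :=
    pullback.lift (𝟙 _) 𝓜.univ.pol.lam.left (by rw [Category.id_comp]; exact (Over.w 𝓜.univ.pol.lam).symm) with hGr
  have hGr₁ : Gr ≫ pullback.fst _ _ = 𝟙 _ := pullback.lift_fst _ _ _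
  have hGr₂ : Gr ≫ pullback.snd _ _ = 𝓜.univ.pol.lam.left := pullback.lift_snd _ _ _
  have hL𝓛 : IsFiniteLocallyFree ((Scheme.Modules.pullback Gr).obj 𝓜.univ.D.P) :=
    (HasRank.isFiniteLocallyFree' 𝓜.univ.D.hasRank_one).pullback Gr
  set L : CechPic 𝓜.univ.A.X.left := (detClass hL𝓛)⁻¹ with hL
  /- ### per fibre: the class `c_y := (j ≫ G y)^*[L^Δ(λ)]` has `φ_{c_y} = φ_{Θ y}²`, hence is an ample translate of `2 Θ y` -/
  have hdim : ∀ y : W, ((P' y).A.fibre (𝟙 (Spec (CommRingCat.of ℂ)))).toAbelianVariety.dim = g := fun y ↦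
    AbelianVariety.dim_eq_of_isAnalytification_pi (hφ y)
  have hphi : ∀ (y : W) (z : ((P' y).A.fibre (𝟙 (Spec (CommRingCat.of ℂ)))).toAbelianVariety.Points ℂ),
      AbelianVarieties.phiPic _ (CechPic.pullback (pullback.fst (P' y).A.X.hom (𝟙 (Spec (CommRingCat.of ℂ))) ≫ G y) (detClass hL𝓛)) z =
        AbelianVarieties.phiPic _ (Θ y).cechClass z ^ 2 := by
    intro y z
    obtain ⟨-, -, ⟨wG, wĜ, ⟨e⟩⟩, hlamG⟩ := hbc y
    exact 𝓜.univ.A.phiPic_pullback_detClass_LDelta_of_isBaseChangeVia 𝓜.univ.D 𝓜.univ.pol.lam (P' y).A (P' y).D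
      (P' y).pol.lam _ (G y) (Ĝ y) wG wĜ Gr hGr₁ hGr₂
      (pullback.lift (𝟙 _) (P' y).pol.lam.left (by rw [Category.id_comp]; exact (Over.w (P' y).pol.lam).symm))
      (pullback.lift_fst _ _ _) (pullback.lift_snd _ _ _) (𝟙 (Spec (CommRingCat.of ℂ))) hlamG e hL𝓛 rfl (hlam y) z
  have htr : ∀ y : W, ∃ Dy : CartierDivisor ((P' y).A.fibre (𝟙 (Spec (CommRingCat.of ℂ)))).toAbelianVariety.X.left,
      CechPic.pullback (pullback.fst (P' y).A.X.hom (𝟙 (Spec (CommRingCat.of ℂ))) ≫ G y) (detClass hL𝓛) = Dy.cechClass ∧ Dy.IsAmple := by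
    intro y
    obtain ⟨t, ht, hamp⟩ := AbelianVariety.exists_eq_cechClass_pullback_translation_two_smul_of_phiPic_eq_sq
      ((P' y).A.fibre (𝟙 (Spec (CommRingCat.of ℂ)))).toAbelianVariety (hΘ y) _ (hphi y)
    exact ⟨_, ht, hamp⟩
  obtain ⟨D₀, hD₀, hD₀amp⟩ := htr x₀
  obtain ⟨D₁, hD₁, hD₁amp⟩ := htr x
  /- ### one `(q, K)` for the pair, closed immersions, hyperplane divisors -/
  obtain ⟨q, hq, K, hK₀, ⟨ψ₀, hψ₀, a₀, ha₀, hlin₀⟩, ⟨ψ₁, hψ₁, a₁, ha₁, hlin₁⟩⟩ :=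
    CartierDivisor.IsAmple.exists_common_pos_smul_linEquiv_hyperplaneDivisor_le hD₀amp hD₁amp (max g 1)
  haveI := hψ₀
  haveI := hψ₁
  have hK1 : 1 ≤ K := le_trans (le_max_right g 1) hK₀
  have hgK : g ≤ K := le_trans (le_max_left g 1) hK₀
  /- ### the `ℙᴷ` Hodge model, its line constant `μ`, and ONE rigidity scalar `r` for all torus models of record -/
  haveI hPT2 : T2Space (ComplexPoints (projectiveSpace K ℂ)) :=
    ComplexPoints.t2Space_of_isSmoothProjective (isSmoothProjective_projectiveSpace' K)
  haveI : CompactSpace (ComplexPoints (projectiveSpace K ℂ)) :=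
    ComplexPoints.compactSpace_of_isSmoothProjective (isSmoothProjective_projectiveSpace' K)
  haveI hPpc : ParacompactSpace (ComplexPoints (projectiveSpace K ℂ)) := inferInstance
  obtain ⟨B⟩ : Nonempty (HodgeModel K (projectiveSpace K ℂ)) := nonempty_hodgeModel_holds (isSmoothProjective_projectiveSpace' K)
  have hj₁ : genericPoint (projectiveSpace K ℂ).left ∈ (GeneratingSections.affineChartData (𝟙 (projectiveSpace K ℂ))).U 0 :=
    ProjSpace.genericPoint_mem_U (d := K) (K := ℂ) 0
  obtain ⟨μ, hμ0, hμ⟩ := exists_ne_zero_coreEulerClass_eq_smul_chernCharacter_projectiveSpace B 0 hj₁ hK1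
  obtain ⟨r, hr0, hr⟩ := exists_ne_zero_forall_abelianVariety_torusModel_deRham_eq_smul_inducedIso
    (e₀ := (Literature.NumberTheory.Transcendental.integrationDeRhamIsoFamily (Fin g → ℂ)).complexify)
    integrationFamily_isNatural B hgK (2 * 1)
    ((P' x₀).A.fibre (𝟙 (Spec (CommRingCat.of ℂ)))).toAbelianVariety (Φ x₀) (φ x₀) (hφ x₀)
  /- ### the global class -/
  obtain ⟨cX, hcX⟩ : ∃ cX : UnitCocycle ((Motives.baseChange ℚ ℂ).obj (univTotal 𝓜)).left,
      CechPic.mk cX = CechPic.pullback (baseChangeHomFst (algebraMap ℚ ℂ) (univTotal 𝓜)) L ^ q :=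
    CechPic.mk_surjective _
  /- ### the fibre reading (once, for every `y`, given its translate, embedding and Appell–Humbert datum) -/
  have key : ∀ (y : W) (py : ComplexTorus.AHData (Φ y))
      (_hpy : ComplexTorus.AHData.toPic py =
        ComplexTorus.picClass (HodgeTheory.cartierDivisorLineBundle (hφ y) (Θ y)))
      (Dy : CartierDivisor ((P' y).A.fibre (𝟙 (Spec (CommRingCat.of ℂ)))).toAbelianVariety.X.left)
      (_hDy : CechPic.pullback (pullback.fst (P' y).A.X.hom (𝟙 (Spec (CommRingCat.of ℂ))) ≫ G y) (detClass hL𝓛) = Dy.cechClass)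
      (ψ : ((P' y).A.fibre (𝟙 (Spec (CommRingCat.of ℂ)))).toAbelianVariety.X ⟶ projectiveSpace K ℂ)
      (_ : IsClosedImmersion ψ.left) (a : Fin (K + 1))
      (ha : genericPoint ((P' y).A.fibre (𝟙 (Spec (CommRingCat.of ℂ)))).toAbelianVariety.X.left ∈
        (GeneratingSections.ofHom ψ.left).U a)
      (_hlin : (q • Dy).LinEquiv ((GeneratingSections.ofHom ψ.left).divisor a ha)),
      HodgeTheory.complexBetti.map (Motives.fiberι (W1.univFamilyℂ 𝓜) y.1) 2
          (eulerClass ℂ cX.complexCore.Fiber (Module.finrank_self ℂ) ℂ 1) =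
        (μ * r⁻¹ * q : ℂ) • ∑ a, ∑ b, ((ComplexTorus.intGram (Φ y) py.form a b : ℤ) : ℂ) •
          cupProduct (show 1 + 1 = 2 from rfl) (HodgeTheory.ofRatClass _ 1 (γ y a))
            (HodgeTheory.ofRatClass _ 1 (γ y b)) := by
    intro y py hpy Dy hDy ψ hψ a ha hlin
    haveI := hψ
    -- the fibre abelian variety and its instances
    have hSP : IsSmoothProjective ((P' y).A.fibre (𝟙 (Spec (CommRingCat.of ℂ)))).toAbelianVariety.dim
        ((P' y).A.fibre (𝟙 (Spec (CommRingCat.of ℂ)))).toAbelianVariety.X := AbelianVariety.isSmoothProjective_holds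
    haveI : T2Space (ComplexPoints (fibreAV (P' y)).X) := ComplexPoints.t2Space_of_isSmoothProjective hSP
    haveI : CompactSpace (ComplexPoints (fibreAV (P' y)).X) := ComplexPoints.compactSpace_of_isSmoothProjective hSP
    haveI : ParacompactSpace (ComplexPoints (fibreAV (P' y)).X) := inferInstance
    haveI : T2Space (ComplexPoints ((P' y).A.fibre (𝟙 (Spec (CommRingCat.of ℂ)))).toAbelianVariety.X) :=
      ‹T2Space (ComplexPoints (fibreAV (P' y)).X)›
    haveI : ParacompactSpace (ComplexPoints ((P' y).A.fibre (𝟙 (Spec (CommRingCat.of ℂ)))).toAbelianVariety.X) :=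
      ‹ParacompactSpace (ComplexPoints (fibreAV (P' y)).X)›
    have hAm : ((P' y).A.fibre (𝟙 (Spec (CommRingCat.of ℂ)))).toAbelianVariety.dim ≤ K := by rw [hdim y]; exact hgK
    -- the pinned homeomorphism `e y : A_y(ℂ) ≃ₜ X_y(ℂ)`
    let ey : ((P' y).A.fibre (𝟙 (Spec (CommRingCat.of ℂ)))).toAbelianVariety.Points ℂ ≃ₜ
        ComplexPoints (fiberOver (univFamilyℂ 𝓜) y.1) :=
      AlgPoints.homeomorphOfIso (L := ℂ)
        (fibreAVIso (P' y) ≪≫ (fiberUnivIsoOfIsBaseChangeVia 𝓜 y.1 (P' y) (G y) (Ĝ y) (hbc y)).symm)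
    let eyC : C(((P' y).A.fibre (𝟙 (Spec (CommRingCat.of ℂ)))).toAbelianVariety.Points ℂ,
        ComplexPoints (fiberOver (univFamilyℂ 𝓜) y.1)) := ey
    -- the fibre cocycle and ★ (A1)
    obtain ⟨c', hc'⟩ : ∃ c' : UnitCocycle (fibreAV (P' y)).X.left,
        CechPic.mk c' = CechPic.pullback (pullback.fst (P' y).A.X.hom (𝟙 (Spec (CommRingCat.of ℂ))) ≫ G y) L ^ q :=
      CechPic.mk_surjective _
    have hA1 : singularCohomology.map ℂ ℂ eyC 2 (HodgeTheory.complexBetti.map (Motives.fiberι (W1.univFamilyℂ 𝓜) y.1) 2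
        (eulerClass ℂ cX.complexCore.Fiber (Module.finrank_self ℂ) ℂ 1)) =
        eulerClass ℂ c'.complexCore.Fiber (Module.finrank_self ℂ) ℂ 1 :=
      UnivFamilyLDeltaClass.coreEulerClass_fibre_reading 𝓜 y.1 (P' y) (G y) (Ĝ y) (hbc y) L q cX c' hcX hc'
    -- `[c′] = [𝒪(-D_ψ)]` (★ (F-alg) (ii)) and ★ (B) coboundary invariance
    have hmk : CechPic.mk c' = CechPic.mk (-(GeneratingSections.affineChartData ψ).divisor a ha).toUnitCocycle := by
      rw [hc', AbelianVariety.mk_neg_hyperplaneDivisor_toUnitCocycle_eq _ ψ hDy hlin, hL, map_inv, inv_pow]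
      rfl
    have hB := UnitCocycle.coreEulerClass_eq_of_mk_eq ℂ hmk (1 : ℂ)
    -- an Appell–Humbert datum of `𝒪(D_ψ)^an`
    obtain ⟨p', hp'⟩ := ComplexTorus.AHData.toPic_surjective
      (ComplexTorus.picClass (HodgeTheory.cartierDivisorLineBundle (hφ y) ((GeneratingSections.affineChartData ψ).divisor a ha)))
    -- the frame on `A_y(ℂ)`
    have hγA : ∀ b, singularCohomology.map ℚ ℚ (φ y) 1 (singularCohomology.map ℚ ℚ eyC 1 (γ y b)) =
        HodgeTheory.latticeClass (Φ y) b := by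
      intro b
      have h := hframe y b
      rw [singularCohomology.map_comp] at h
      exact h
    -- ★ (F-fib) and ★ (F-alg) (i)
    have hF := AbelianVariety.coreEulerClass_neg_hyperplaneDivisor_eq_smul_sum_intGram_cup
      ((P' y).A.fibre (𝟙 (Spec (CommRingCat.of ℂ)))).toAbelianVariety (Φ y) (φ y) (hφ y) B hAm hr0
      (hr _ (Φ y) (φ y) (hφ y) hAm) 0 hj₁ hμ ψ a ha p' hp'
      (fun b ↦ singularCohomology.map ℚ ℚ eyC 1 (γ y b)) hγA
    have hG := AbelianVariety.intGram_hyperplaneDivisor_eq_nsmul _ (hφ y) (hadd y) ψ (hphi y) hDy hlin py p' hpy hp'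
    -- combine and descend along `e y`
    have halg := reading_algebra eyC (γ y) (ComplexTorus.intGram (Φ y) py.form)
      (ComplexTorus.intGram (Φ y) p'.form) q hG μ r
    have hinj : Function.Injective (singularCohomology.map ℂ ℂ eyC 2) := fun u v huv ↦
      (singularCohomology.mapIso ℂ ℂ ey 2).toLinearEquiv.injective huv
    apply hinj
    rw [hA1, hB]
    exact hF.trans halg
  refine ⟨eulerClass ℂ cX.complexCore.Fiber (Module.finrank_self ℂ) ℂ 1, μ * r⁻¹ * q, ?_,
    key x₀ p₀ hp₀ D₀ hD₀ ψ₀ hψ₀ a₀ ha₀ hlin₀, key x p hp D₁ hD₁ ψ₁ hψ₁ a₁ ha₁ hlin₁⟩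
  exact mul_ne_zero (mul_ne_zero hμ0 (inv_ne_zero hr0)) (by exact_mod_cast hq.ne')

end UnivFamilyPairReading

end Summit.HodgeConjecture.HodgeConjecture.Theorems

end
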